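import Literature.MathematicalPhysics.QuantumFieldTheory.Balaban1983to89.B13OpsYPencilHessian
import Literature.MathematicalPhysics.QuantumFieldTheory.Balaban1983to89.B13OpsYPencilAveraging

/-!
# `Balaban1983to89.B13OpsYPencilDeltaALocal` — T. Bałaban, *Propagators for lattice gauge theories in a background field*, Commun. Math. Phys. **99** (1985)
# 389–434 [Balaban1985BackgroundPropagators], (3.26) p. 395 («Δ_a(U) = Δ(U) + D_U R(U) D*_U + Q*(U)aQ(U)»), (3.12)–(3.13) p. 392 and (3.14) p. 393 (`Q`, `Q*`), (3.10) p. 392 (`Δ(U)`),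
# (3.21), (3.25) pp. 394–395 (the projection `R(U)` — NOT local: it carries `G′ = (Δ′_a)⁻¹` and `(Q′G′²Q′*)⁻¹`), p. 396 («U′ = exp iηA′»), Thm 3.4 p. 400
# («the operators … G(U) extend to configurations U′U … as analytic functions of A′»), (3.27) p. 395 (`G = Δ_a⁻¹`); [Balaban1988RG2Cluster] (2.5) p. 12, p. 15:
# THE LOCAL PART `Δ(U) + Q*(U)aQ(U)` OF NODE 00's `Δ_a(U)` (`Node00.deltaAY = hessY + gradY ∘ RY ∘ divY + QsY ∘ aY ∘ QY`, `Node00/OpsYDeltaA`) ALONG pv27's GROUP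
# PENCIL: the bond-averaging sandwich `Q*(U)aQ(U)` at the transporter letter of record `parBY` and the sum with the Hessian are HOLOMORPHIC in `A′` per input
# field and output bond, with explicit majorants; the remaining summand `D_U R(U) D*_U` is displayed as what it is — the inverse road's (N06 ∕ n10-w2).

statement-level complex analysis ([folklore]) AT NODE 00's `rfl`-level definitions (`aY QY QsY hessY deltaAY RY`), over `B13OpsYPencilHessian` (★★★ `hessY` along
the pencil), `B13OpsYPencilAveraging` (the `qT` facts at `parBY`) and `B13OpsYPencilHolonomy` (the transported lift with an `A′`-dependent input); kernel-checked;
THEOREMS ONLY (no `def`, no `structure`, no instance, no notation); NOTHING of NODE 00's ∕ pv27's is modified; nothing here is a claim about the Yang–Mills mass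
gap; no node is discharged; count-neutral.

WHY THIS FILE (cell `pub-ymgap`, HUMAN RULING D-0062 ∕ D-0149, Track A node N10 = [B13]; seat `pub-ymgap-dag-n10-c` g14, INTENT-8).  Modules 68–74 of the seat
read NODE 00's eight local letters, the Hessian `Δ(U)` and `Δ′_a(U)` along the pencil.  Print's bond-sector operator of record is `Δ_a(U)` (3.26), whose inverse
is `G(U)` (3.27) — Thm 3.4's object.  Of its three summands two are LOCAL (`Δ(U)`, `Q*(U)aQ(U)`) and one carries inverses (`D_U R(U) D*_U`, `R(U) = I −
G′Q′*(Q′G′²Q′*)⁻¹Q′G′`).  THIS FILE closes the local side: §1 a support-restricted version of the transported lift's bound with an `A′`-dependent input (generic),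
§2 the weight operator `a` (`aY`, configuration-independent), §3 ★★ the sandwich `Q*(U)aQ(U)` along the pencil, §4 ★★ the LOCAL PART `Δ(U) + Q*aQ(U)` along the
pencil + `deltaAY_apply_eq` displaying NODE 00's `Δ_a` as «local part + `D_U R(U) D*_U`», so that the inverse road (n10-w2's `B13InverseOperatorCoordinates`, N06's
Thm 3.4 chain) has the operator side of `Δ_a` BY NAME up to the one projection term.

WHAT THIS FILE PROVES (all `theorem`s; `𝔸` NODE 00's complete normed `ℂ`-algebra with `‖1‖ = 1`).
* §1 (generic) `norm_trLiftY_apply_le_of_support` — `B13OpsYPencilHolonomy.norm_trLiftY_apply_le` with the transporter bounds asked only where `M(y,x) ≠ 0`.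
* §2 `aY_apply` (`(aΛ)(ι) = Σ_{ι′} a(ι,ι′)·Λ(ι′)`, NODE 00's `liftMatY`), `differentiableOn_aY_apply` (for an `A′`-dependent holomorphic input), `norm_aY_apply_le`
  (`≤ (Σ|a(ι,·)|)·S`).
* §3 ★ `differentiableOn_QY_prodCfg_apply` ∕ `norm_QY_prodCfg_apply_le` (the bond averaging of a FIXED field along the pencil, support-length numeral `D`),
  ★★ `differentiableOn_QsaQ_prodCfg` — `A′ ↦ ((Q*(U) ∘ a ∘ Q(U))Λ)(b)` at `U = e^{iηA′}U₀`, `parB := parBY`, HOLOMORPHIC on every chart ball for every `Λ`, `b` —,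
  ★★ `norm_QsaQ_prodCfg_le`.
* §4 ★★★ `deltaAY_apply_eq` (`(Δ_a(U)Λ)(b) = (Δ(U)Λ)(b) + ((D_U R(U) D*_U)Λ)(b) + ((Q*aQ)(U)Λ)(b)`, NODE 00's definition), ★★★ `differentiableOn_localDeltaA_prodCfg`
  (`A′ ↦ (Δ(U)Λ)(b) + ((Q*aQ)(U)Λ)(b)` at `U = e^{iηA′}U₀` holomorphic), `norm_localDeltaA_prodCfg_le`.
HONEST FRAMING: NODE 00's DEFINITIONS read along pv27's DEFINITION; inputs are numerals; the projection term `D_U R(U) D*_U` (inverses `G′`, `(Q′G′²Q′*)⁻¹`) is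
NOT treated — it is the inverse road's; nothing of Bałaban's asserted; N06 ∕ N10 NOT discharged; K1⁷ NOT closed; counts unmoved (typed 28∕28 · discharged
5∕27); no `sorry`, no new named fact; standard axioms; one finite 𝕋⁴ programme at fixed ε, Bałaban AS PRINTED; the YM mass gap (Clay) is NOT proved by any of
this — R4 closes the conditional finite-𝕋⁴ rung `BalabanLadder.UV` only; nothing continuum ∕ ℝ⁴ ∕ OS.

References: T. Bałaban, CMP 99 (1985) 389–434 [Balaban1985BackgroundPropagators] (3.10) p.392, (3.12)–(3.14) pp.392–393, (3.21), (3.25)–(3.27) pp.394–395, Thm 3.4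
p.400; CMP 116 (1988) 1–22 [Balaban1988RG2Cluster] (2.5) p.12, p.15.
-/

noncomputable section

namespace Literature.MathematicalPhysics.QuantumFieldTheory.Balaban1983to89.B13OpsYPencilDeltaALocal

open Metric Set Complex
open NormedSpace (exp)
open Literature.MathematicalPhysics.QuantumFieldTheory.Balaban1983to89
open Literature.MathematicalPhysics.QuantumFieldTheory.Balaban1983to89.B9Eq39Adjoint (R R_def prodCfg)
open Literature.MathematicalPhysics.QuantumFieldTheory.Balaban1983to89.B6GlobalChartV1 (PV boxEquiv)
open Literature.MathematicalPhysics.QuantumFieldTheory.Balaban1983to89.B6KLevelCensusIndexV1 (KIdx)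
open Literature.MathematicalPhysics.QuantumFieldTheory.Balaban1983to89.B15DeterminingSets (embIter)
open Literature.MathematicalPhysics.QuantumFieldTheory.Balaban1983to89.Node00
  (SiteY FBondY IBondY CfgY qK qsK aK qT QY QsY aY hessY gradY divY RY deltaAY parBY trLiftY trLiftY_apply liftMatY_apply)
open Literature.MathematicalPhysics.QuantumFieldTheory.Balaban1983to89.B13OpsYPencilHolonomy (differentiableOn_trLiftY_apply)
open Literature.MathematicalPhysics.QuantumFieldTheory.Balaban1983to89.B13OpsYPencilHessian
  (differentiableOn_hessY_prodCfg norm_hessY_prodCfg_le)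
open Literature.MathematicalPhysics.QuantumFieldTheory.Balaban1983to89.B13OpsYPencilAveraging
  (differentiableOn_qT_prodCfg differentiableOn_qT_inv_prodCfg norm_qT_prodCfg_le norm_qT_inv_prodCfg_le)

variable {𝔸 : Type} [NormedRing 𝔸] [NormedAlgebra ℂ 𝔸] [CompleteSpace 𝔸]

/-! ## §1. The transported lift of a u-dependent field, transporter bounds on the kernel's support (generic) -/

section Generic

variable {X Y : Type} [Fintype X]
variable {E : Type*} [NormedAddCommGroup E] [NormedSpace ℂ E]
variable (M : Matrix Y X ℝ) (T : E → Y → X → 𝔸ˣ) {Rc Kf Kb S : ℝ}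

omit [CompleteSpace 𝔸] [NormedSpace ℂ E] in
/-- **THE TRANSPORTED LIFT OF A u-DEPENDENT FIELD, BOUNDED WITH TRANSPORTER BOUNDS ON THE SUPPORT**: `‖T(u)(y,x)‖ ≤ Kf`, `‖T(u)(y,x)⁻¹‖ ≤ Kb` wherever
`M(y,x) ≠ 0`, `‖Ψ(u)(x)‖ ≤ S` ⟹ `‖(M♯_{T(u)}Ψ(u))(y)‖ ≤ (Σ_x |M(y,x)|)·(Kf·S·Kb)` (for contour-transported averagings: the length is the block's).
[cite: Balaban1985BackgroundPropagators, (3.12)–(3.14) pp.392–393, Thm 3.4 p.400] -/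
theorem norm_trLiftY_apply_le_of_support (hK0 : 0 ≤ Kf)
    (hKf : ∀ u ∈ ball (0 : E) Rc, ∀ y x, M y x ≠ 0 → ‖(T u y x : 𝔸)‖ ≤ Kf)
    (hKb : ∀ u ∈ ball (0 : E) Rc, ∀ y x, M y x ≠ 0 → ‖(((T u y x)⁻¹ : 𝔸ˣ) : 𝔸)‖ ≤ Kb)
    {Ψ : E → X → 𝔸} (hS : ∀ u ∈ ball (0 : E) Rc, ∀ x, ‖Ψ u x‖ ≤ S) {u : E} (hu : u ∈ ball (0 : E) Rc) (y : Y) :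
    ‖trLiftY M (T u) (Ψ u) y‖ ≤ (∑ x, |M y x|) * (Kf * S * Kb) := by
  rw [trLiftY_apply, Finset.sum_mul]
  refine (norm_sum_le _ _).trans (Finset.sum_le_sum fun x _ => ?_)
  by_cases hM : M y x = 0
  · rw [hM, Complex.ofReal_zero, zero_smul, norm_zero, abs_zero, zero_mul]
  rw [norm_smul, Complex.norm_real, Real.norm_eq_abs, R_def]
  refine mul_le_mul_of_nonneg_left ?_ (abs_nonneg _)
  have hf := hKf u hu y x hM
  have hb := hKb u hu y x hM
  have hs := hS u hu x
  have h1 : 0 ≤ S := (norm_nonneg _).trans hs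
  calc ‖(T u y x : 𝔸) * Ψ u x * (((T u y x)⁻¹ : 𝔸ˣ) : 𝔸)‖
      ≤ ‖(T u y x : 𝔸) * Ψ u x‖ * ‖(((T u y x)⁻¹ : 𝔸ˣ) : 𝔸)‖ := norm_mul_le _ _
    _ ≤ Kf * S * Kb :=
        mul_le_mul ((norm_mul_le _ _).trans (mul_le_mul hf hs (norm_nonneg _) hK0)) hb (norm_nonneg _) (mul_nonneg hK0 h1)

end Generic

variable {d ℓ : ℕ} {hd : 1 ≤ d + 1} {hL : Odd (ℓ + 1) ∧ 1 < ℓ + 1} {b₀ b₁ : ℝ}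
variable (i : KIdx d ℓ hd hL b₀ b₁) (U₀ : CfgY 𝔸 i) (η : ℝ) {Rc K₀ S : ℝ} {D : ℕ}

/-! ## §2. The weight operator `a` (configuration-independent) -/

section Weight

omit [CompleteSpace 𝔸] in
/-- NODE 00's weight operator, unfolded: `(aΛ)(ι) = Σ_{ι′} a(ι,ι′)·Λ(ι′)` (`aY = liftMatY aK`). [cite: Balaban1985BackgroundPropagators, (3.26) p.395; Balaban1984PropagatorsII, (2.19) p.226] -/
theorem aY_apply [CompleteSpace 𝔸] (Λ : IBondY i → 𝔸) (ι : IBondY i) : aY i Λ ι = ∑ ι', ((aK i ι ι' : ℝ) : ℂ) • Λ ι' := liftMatY_apply 𝔸 (aK i) Λ ι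

/-- The weight operator of an `A′`-dependent holomorphic field is holomorphic. [cite: Balaban1985BackgroundPropagators, (3.26) p.395, Thm 3.4 p.400] -/
theorem differentiableOn_aY_apply {Ψ : (Fin (d + 1) → Site (PV d ℓ i.m i.K hd hL) 0 → 𝔸) → IBondY i → 𝔸}
    (hΨ : ∀ ι, DifferentiableOn ℂ (fun a => Ψ a ι) (ball 0 Rc)) (ι : IBondY i) :
    DifferentiableOn ℂ (fun a => aY i (Ψ a) ι) (ball (0 : Fin (d + 1) → Site (PV d ℓ i.m i.K hd hL) 0 → 𝔸) Rc) := by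
  simp only [aY_apply]
  exact DifferentiableOn.fun_sum fun ι' _ => (hΨ ι').const_smul (((aK i ι ι' : ℝ) : ℂ))

omit [CompleteSpace 𝔸] in
/-- … and bounded by `(Σ_{ι′} |a(ι,ι′)|)·S` when `‖Ψ(A′)(ι′)‖ ≤ S`. [cite: Balaban1985BackgroundPropagators, (3.26) p.395] -/
theorem norm_aY_apply_le [CompleteSpace 𝔸] {Ψ : (Fin (d + 1) → Site (PV d ℓ i.m i.K hd hL) 0 → 𝔸) → IBondY i → 𝔸}
    (hS : ∀ a ∈ ball (0 : Fin (d + 1) → Site (PV d ℓ i.m i.K hd hL) 0 → 𝔸) Rc, ∀ ι, ‖Ψ a ι‖ ≤ S)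
    {a : Fin (d + 1) → Site (PV d ℓ i.m i.K hd hL) 0 → 𝔸} (ha : a ∈ ball 0 Rc) (ι : IBondY i) :
    ‖aY i (Ψ a) ι‖ ≤ (∑ ι', |aK i ι ι'|) * S := by
  rw [aY_apply, Finset.sum_mul]
  refine (norm_sum_le _ _).trans (Finset.sum_le_sum fun ι' _ => ?_)
  rw [norm_smul, Complex.norm_real, Real.norm_eq_abs]
  exact mul_le_mul_of_nonneg_left (hS a ha ι') (abs_nonneg _)

end Weight

/-! ## §3. ★★ The bond-averaging sandwich `Q*(U) a Q(U)` at `parBY`, along the pencil -/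

section Sandwich

/-- ★ The covariant bond averaging of a FIXED field along the pencil is holomorphic: `A′ ↦ (Q(e^{iηA′}U₀)Λ)(ι)`, `parB := parBY`.
[cite: Balaban1985BackgroundPropagators, (3.12) p.392, Thm 3.4 p.400] -/
theorem differentiableOn_QY_prodCfg_apply (Λ : FBondY i → 𝔸) (ι : IBondY i) :
    DifferentiableOn ℂ (fun a => QY i (parBY i) (prodCfg U₀ η a) Λ ι) (ball (0 : Fin (d + 1) → Site (PV d ℓ i.m i.K hd hL) 0 → 𝔸) Rc) :=
  differentiableOn_trLiftY_apply (qK i) (fun a => qT i (parBY i) (prodCfg U₀ η a)) (Rc := Rc) (differentiableOn_qT_prodCfg i U₀ η)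
    (differentiableOn_qT_inv_prodCfg i U₀ η) (Ψ := fun _ => Λ) (fun x => differentiableOn_const (Λ x)) ι

/-- ★★ **`A′ ↦ ((Q*(U) ∘ a ∘ Q(U))Λ)(b)` AT `U = e^{iηA′}U₀`, `parB := parBY`, IS HOLOMORPHIC** on every chart ball for every `Λ`, `b` (the third summand of
`Δ_a(U)`, (3.26)). [cite: Balaban1985BackgroundPropagators, (3.26) p.395, (3.12)–(3.13) p.392, Thm 3.4 p.400] -/
theorem differentiableOn_QsaQ_prodCfg (Λ : FBondY i → 𝔸) (b : FBondY i) :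
    DifferentiableOn ℂ (fun a => (QsY i (parBY i) (prodCfg U₀ η a) ∘ₗ aY i ∘ₗ QY i (parBY i) (prodCfg U₀ η a)) Λ b)
      (ball (0 : Fin (d + 1) → Site (PV d ℓ i.m i.K hd hL) 0 → 𝔸) Rc) := by
  simp only [LinearMap.comp_apply]
  refine differentiableOn_trLiftY_apply (qsK i) (fun a b ι => (qT i (parBY i) (prodCfg U₀ η a) ι b)⁻¹) (Rc := Rc)
    (fun b ι => differentiableOn_qT_inv_prodCfg i U₀ η ι b) (fun b ι => ?_)
    (Ψ := fun a => aY i (QY i (parBY i) (prodCfg U₀ η a) Λ)) (fun ι => ?_) b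
  · simpa only [inv_inv] using differentiableOn_qT_prodCfg i U₀ η (Rc := Rc) ι b
  · exact differentiableOn_aY_apply i (fun ι' => differentiableOn_QY_prodCfg_apply i U₀ η Λ ι') ι

variable [NormOneClass 𝔸]

/-- ★ … the bond averaging of a fixed field is bounded by `c_Q·(Kη^D·‖Λ‖·Kη^D)` on `‖A′‖ < R` (`c_Q ≥ Σ_b |qK(ι,b)|`; support-length numeral `D`:
`qK(ι,b) ≠ 0 ⇒ tdist(corner ι, b.src) ≤ D`). [cite: Balaban1985BackgroundPropagators, (3.12) p.392, (3.40) p.397, Thm 3.4 p.400] -/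
theorem norm_QY_prodCfg_apply_le (hU : ∀ μ x, ‖(U₀ μ x : 𝔸)‖ ≤ K₀) (hUi : ∀ μ x, ‖(((U₀ μ x)⁻¹ : 𝔸ˣ) : 𝔸)‖ ≤ K₀) (hK1 : 1 ≤ K₀) (hRc : 0 ≤ Rc)
    (hD : ∀ ι b, qK i ι b ≠ 0 → Site.tdist (embIter (ι.1.1 : ℕ) ι.1.2.src) b.src ≤ D) {cQ : ℝ} (hcQ : ∀ ι, ∑ b, |qK i ι b| ≤ cQ)
    (Λ : FBondY i → 𝔸) {a : Fin (d + 1) → Site (PV d ℓ i.m i.K hd hL) 0 → 𝔸} (ha : a ∈ ball 0 Rc) (ι : IBondY i) :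
    ‖QY i (parBY i) (prodCfg U₀ η a) Λ ι‖ ≤ cQ * ((K₀ * Real.exp (|η| * Rc)) ^ D * ‖Λ‖ * (K₀ * Real.exp (|η| * Rc)) ^ D) := by
  have h1 : (1 : ℝ) ≤ K₀ * Real.exp (|η| * Rc) :=
    one_le_mul_of_one_le_of_one_le hK1 (Real.one_le_exp (mul_nonneg (abs_nonneg _) hRc))
  have h0 : (0 : ℝ) ≤ (K₀ * Real.exp (|η| * Rc)) ^ D := pow_nonneg (zero_le_one.trans h1) D
  refine (norm_trLiftY_apply_le_of_support (qK i) (fun a => qT i (parBY i) (prodCfg U₀ η a)) h0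
    (fun a ha ι b hM => (norm_qT_prodCfg_le i U₀ η hU hUi hRc ha ι b).trans (pow_le_pow_right₀ h1 (hD ι b hM)))
    (fun a ha ι b hM => (norm_qT_inv_prodCfg_le i U₀ η hU hUi hRc ha ι b).trans (pow_le_pow_right₀ h1 (hD ι b hM)))
    (Ψ := fun _ => Λ) (fun _ _ b => norm_le_pi_norm Λ b) ha ι).trans ?_
  exact mul_le_mul_of_nonneg_right (hcQ ι) (mul_nonneg (mul_nonneg h0 (norm_nonneg _)) h0)

/-- ★★ **… WITH THE BOUND** `‖((Q*aQ)(e^{iηA′}U₀)Λ)(b)‖ ≤ c_{Q*}·(Kη^D·(c_a·(c_Q·(Kη^D·‖Λ‖·Kη^D)))·Kη^D)` on `‖A′‖ < R` (`c_{Q*} ≥ Σ_ι |qsK(b,ι)|`, `c_a ≥ Σ|a(ι,·)|`,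
`c_Q ≥ Σ_b |qK(ι,b)|`; support-length `D` for both `qK` and `qsK`; `0 ≤ c_a`, `0 ≤ c_Q`). [cite: Balaban1985BackgroundPropagators, (3.26) p.395, (3.12)–(3.13) p.392, Thm 3.4 p.400] -/
theorem norm_QsaQ_prodCfg_le (hU : ∀ μ x, ‖(U₀ μ x : 𝔸)‖ ≤ K₀) (hUi : ∀ μ x, ‖(((U₀ μ x)⁻¹ : 𝔸ˣ) : 𝔸)‖ ≤ K₀) (hK1 : 1 ≤ K₀) (hRc : 0 ≤ Rc)
    (hD : ∀ ι b, qK i ι b ≠ 0 → Site.tdist (embIter (ι.1.1 : ℕ) ι.1.2.src) b.src ≤ D)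
    (hD' : ∀ b ι, qsK i b ι ≠ 0 → Site.tdist (embIter (ι.1.1 : ℕ) ι.1.2.src) b.src ≤ D)
    {cQ cQs ca : ℝ} (hcQ0 : 0 ≤ cQ) (hca0 : 0 ≤ ca) (hcQ : ∀ ι, ∑ b, |qK i ι b| ≤ cQ) (hcQs : ∀ b, ∑ ι, |qsK i b ι| ≤ cQs)
    (hca : ∀ ι, ∑ ι', |aK i ι ι'| ≤ ca)
    (Λ : FBondY i → 𝔸) {a : Fin (d + 1) → Site (PV d ℓ i.m i.K hd hL) 0 → 𝔸} (ha : a ∈ ball 0 Rc) (b : FBondY i) :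
    ‖(QsY i (parBY i) (prodCfg U₀ η a) ∘ₗ aY i ∘ₗ QY i (parBY i) (prodCfg U₀ η a)) Λ b‖ ≤
      cQs * ((K₀ * Real.exp (|η| * Rc)) ^ D *
        (ca * (cQ * ((K₀ * Real.exp (|η| * Rc)) ^ D * ‖Λ‖ * (K₀ * Real.exp (|η| * Rc)) ^ D))) * (K₀ * Real.exp (|η| * Rc)) ^ D) := by
  simp only [LinearMap.comp_apply]
  have h1 : (1 : ℝ) ≤ K₀ * Real.exp (|η| * Rc) :=
    one_le_mul_of_one_le_of_one_le hK1 (Real.one_le_exp (mul_nonneg (abs_nonneg _) hRc))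
  have h0 : (0 : ℝ) ≤ (K₀ * Real.exp (|η| * Rc)) ^ D := pow_nonneg (zero_le_one.trans h1) D
  have hΨ : ∀ a ∈ ball (0 : Fin (d + 1) → Site (PV d ℓ i.m i.K hd hL) 0 → 𝔸) Rc, ∀ ι,
      ‖aY i (QY i (parBY i) (prodCfg U₀ η a) Λ) ι‖ ≤ ca * (cQ * ((K₀ * Real.exp (|η| * Rc)) ^ D * ‖Λ‖ * (K₀ * Real.exp (|η| * Rc)) ^ D)) :=
    fun a ha ι => (norm_aY_apply_le i (Ψ := fun a => QY i (parBY i) (prodCfg U₀ η a) Λ)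
      (fun a ha ι' => norm_QY_prodCfg_apply_le i U₀ η hU hUi hK1 hRc hD hcQ Λ ha ι') ha ι).trans
      (mul_le_mul_of_nonneg_right (hca ι) (mul_nonneg hcQ0 (mul_nonneg (mul_nonneg h0 (norm_nonneg _)) h0)))
  have hTb : ∀ a ∈ ball (0 : Fin (d + 1) → Site (PV d ℓ i.m i.K hd hL) 0 → 𝔸) Rc, ∀ (b : FBondY i) (ι : IBondY i), qsK i b ι ≠ 0 →
      ‖((((qT i (parBY i) (prodCfg U₀ η a) ι b)⁻¹)⁻¹ : 𝔸ˣ) : 𝔸)‖ ≤ (K₀ * Real.exp (|η| * Rc)) ^ D := by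
    intro a ha b ι hM
    rw [inv_inv]
    exact (norm_qT_prodCfg_le i U₀ η hU hUi hRc ha ι b).trans (pow_le_pow_right₀ h1 (hD' b ι hM))
  have h := norm_trLiftY_apply_le_of_support (qsK i) (fun a b ι => (qT i (parBY i) (prodCfg U₀ η a) ι b)⁻¹) h0
    (fun a ha b ι hM => (norm_qT_inv_prodCfg_le i U₀ η hU hUi hRc ha ι b).trans (pow_le_pow_right₀ h1 (hD' b ι hM))) hTb
    (Ψ := fun a => aY i (QY i (parBY i) (prodCfg U₀ η a) Λ)) hΨ ha b
  refine h.trans (mul_le_mul_of_nonneg_right (hcQs b) (mul_nonneg (mul_nonneg h0 ?_) h0))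
  exact mul_nonneg hca0 (mul_nonneg hcQ0 (mul_nonneg (mul_nonneg h0 (norm_nonneg _)) h0))

end Sandwich

/-! ## §4. ★★★ The local part `Δ(U) + Q*(U)aQ(U)` of `Δ_a(U)` along the pencil -/

section LocalPart

/-- ★★★ **NODE 00's `Δ_a(U)`, APPLIED**: `(Δ_a(U)Λ)(b) = (Δ(U)Λ)(b) + ((D_U R(U) D*_U)Λ)(b) + ((Q*(U)aQ(U))Λ)(b)` (definition `deltaAY = hessY + gradY ∘ RY ∘ divY +
QsY ∘ aY ∘ QY`; the middle summand carries the projection `R(U)` with the inverses `G′ = (Δ′_a)⁻¹`, `(Q′G′²Q′*)⁻¹` — the inverse road's).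
[cite: Balaban1985BackgroundPropagators, (3.26) p.395, (3.25) p.394] -/
theorem deltaAY_apply_eq (parS : Node00.SiteParY 𝔸 i) (parB : Node00.BondParY 𝔸 i) (Gp : Node00.SiteOpY 𝔸 i) (U : CfgY 𝔸 i)
    (Λ : FBondY i → 𝔸) (b : FBondY i) :
    deltaAY i parS parB Gp U Λ b =
      hessY i U Λ b + (gradY i U ∘ₗ RY i parS Gp U ∘ₗ divY i U) Λ b + (QsY i parB U ∘ₗ aY i ∘ₗ QY i parB U) Λ b := rfl

/-- ★★★ **THE LOCAL PART OF `Δ_a` ALONG THE PENCIL IS HOLOMORPHIC**: `A′ ↦ (Δ(U)Λ)(b) + ((Q*(U)aQ(U))Λ)(b)` at `U = e^{iηA′}U₀` (`parB := parBY`) on every chart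
ball, for every `Λ`, `b`. [cite: Balaban1985BackgroundPropagators, (3.26) p.395, (3.10) p.392, Thm 3.4 and (3.50) p.400] -/
theorem differentiableOn_localDeltaA_prodCfg (Λ : FBondY i → 𝔸) (b : FBondY i) :
    DifferentiableOn ℂ (fun a => hessY i (prodCfg U₀ η a) Λ b +
        (QsY i (parBY i) (prodCfg U₀ η a) ∘ₗ aY i ∘ₗ QY i (parBY i) (prodCfg U₀ η a)) Λ b)
      (ball (0 : Fin (d + 1) → Site (PV d ℓ i.m i.K hd hL) 0 → 𝔸) Rc) :=
  (differentiableOn_hessY_prodCfg i U₀ η Λ b).add (differentiableOn_QsaQ_prodCfg i U₀ η Λ b)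

variable [NormOneClass 𝔸]

open Classical in
/-- ★★ **… WITH THE BOUND** = (71's Hessian majorant) + (§3's sandwich majorant) on `‖A′‖ < R`.
[cite: Balaban1985BackgroundPropagators, (3.26) p.395, Thm 3.4 p.400] -/
theorem norm_localDeltaA_prodCfg_le (hU : ∀ μ x, ‖(U₀ μ x : 𝔸)‖ ≤ K₀) (hUi : ∀ μ x, ‖(((U₀ μ x)⁻¹ : 𝔸ˣ) : 𝔸)‖ ≤ K₀) (hK1 : 1 ≤ K₀)
    (hRc : 0 ≤ Rc) {c₁ c₂ : ℝ} (hc₀ : 0 ≤ c₁) (hc₁ : ∀ p, ∑ b, |Node00.curlK i p b| ≤ c₁) (hc₂ : ∀ b, ∑ p, |Node00.cocurlK i b p| ≤ c₂) {Nb : ℝ}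
    (b : FBondY i)
    (hNb : (((Finset.univ : Finset (Node00.PlaqY i)) ×ˢ (Finset.univ : Finset (Fin 4))).filter fun pm => Node00.edgeY i pm.1 pm.2 = b).card ≤ Nb)
    (hD : ∀ ι b, qK i ι b ≠ 0 → Site.tdist (embIter (ι.1.1 : ℕ) ι.1.2.src) b.src ≤ D)
    (hD' : ∀ b ι, qsK i b ι ≠ 0 → Site.tdist (embIter (ι.1.1 : ℕ) ι.1.2.src) b.src ≤ D)
    {cQ cQs ca : ℝ} (hcQ0 : 0 ≤ cQ) (hca0 : 0 ≤ ca) (hcQ : ∀ ι, ∑ b, |qK i ι b| ≤ cQ) (hcQs : ∀ b, ∑ ι, |qsK i b ι| ≤ cQs)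
    (hca : ∀ ι, ∑ ι', |aK i ι ι'| ≤ ca)
    (Λ : FBondY i → 𝔸) {a : Fin (d + 1) → Site (PV d ℓ i.m i.K hd hL) 0 → 𝔸} (ha : a ∈ ball 0 Rc) :
    ‖hessY i (prodCfg U₀ η a) Λ b + (QsY i (parBY i) (prodCfg U₀ η a) ∘ₗ aY i ∘ₗ QY i (parBY i) (prodCfg U₀ η a)) Λ b‖ ≤
      (c₂ * (K₀ * Real.exp (|η| * Rc) *
          ((K₀ * Real.exp (|η| * Rc)) ^ 4 * (c₁ * (K₀ * Real.exp (|η| * Rc) * ‖Λ‖ * (K₀ * Real.exp (|η| * Rc))))) *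
          (K₀ * Real.exp (|η| * Rc))) +
        1 / 2 * (Nb * (K₀ * Real.exp (|η| * Rc) *
          (2 * (i.cf ^ 2 * (K₀ * Real.exp (|η| * Rc)) ^ 4) * (8 * (K₀ * Real.exp (|η| * Rc) * ‖Λ‖ * (K₀ * Real.exp (|η| * Rc))))) *
          (K₀ * Real.exp (|η| * Rc))))) +
      cQs * ((K₀ * Real.exp (|η| * Rc)) ^ D *
        (ca * (cQ * ((K₀ * Real.exp (|η| * Rc)) ^ D * ‖Λ‖ * (K₀ * Real.exp (|η| * Rc)) ^ D))) * (K₀ * Real.exp (|η| * Rc)) ^ D) :=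
  (norm_add_le _ _).trans (add_le_add (norm_hessY_prodCfg_le i U₀ η hU hUi hK1 hRc hc₀ hc₁ hc₂ b hNb Λ ha)
    (norm_QsaQ_prodCfg_le i U₀ η hU hUi hK1 hRc hD hD' hcQ0 hca0 hcQ hcQs hca Λ ha b))

end LocalPart

end Literature.MathematicalPhysics.QuantumFieldTheory.Balaban1983to89.B13OpsYPencilDeltaALocal

end
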